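import Literature.Topology.FourManifolds.TubeLinkFamily
import Literature.Topology.FourManifolds.CircleLinkBijective
import HarnessLib

/-!
# The ray homeomorphism of a conewise-linear homeomorphism, and circle links close to it

Topic `Literature/Topology/FourManifolds`; second half of the `k = 1` link step of the smoothing
of PD homeomorphisms (Munkres, Ann. of Math. 72 (1960), §4; Campbell–D'Onofrio–Vítek (2026),
Lemma 3.2).  The conewise differential of a PD homeomorphism at a point is a positively
homogeneous HOMEOMORPHISM `L` bounded below by `μ ‖·‖` (Munkres (1966), Thm. 8.4;
`PDDifferential.exists_homeomorph_coneDifferential`), and the radial rescalings of the map converge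
to it uniformly.  Here:

* `rayMap`, `rayHomeomorph` — the ray map `θ ↦ L θ / ‖L θ‖` of a positively homogeneous
  homeomorphism `L` of `ℝᵏ⁺¹` is a homeomorphism of `𝕊ᵏ` (inverse: the ray map of `L⁻¹`);
* `norm_inv_norm_smul_sub_inv_norm_smul_le` — `‖a/‖a‖ - b/‖b‖‖ ≤ 2 ‖a - b‖ / ‖b‖`;
* `norm_linkSphereMap_sub_rayHomeomorph_lt` — if `‖r₁⁻¹ N (x₀, r₁ θ) - L θ‖ ≤ δ` on the unit
  sphere with `2δ < μ`, then `N ≠ 0` at the link level and the link map `linkSphereMap θ₀ N r₁ x₀`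
  is pointwise at chordal distance `< 1` from `rayHomeomorph θ₀ L`;
* `exists_linkDiffeomorph_circle` — consequently (`k = 1`), with the pointwise smoothness,
  fibre-injectivity and transversality of the readable shell at the link level, the circle link
  map is a diffeomorphism of `𝕊¹` (`CircleLinkBijective.exists_diffeomorph_circle_of_close`).

The two definitions are explicit constructions (no named facts); everything is proved.

## References

* J. R. Munkres, *Obstructions to the smoothing of piecewise-differentiable homeomorphisms*, Ann.
  of Math. (2) 72 (1960), 521–554, §4. [Munkres1960]
* J. R. Munkres, *Elementary differential topology* (1966), §8, Thm. 8.4. [Munkres1966]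
* D. Campbell, L. D'Onofrio, T. Vítek, *Diffeomorphic approximation of piecewise affine
  homeomorphisms*, J. Geom. Anal. 36 (2026), Lemma 3.2. [CampbellDonofrioVitek2026]
-/

noncomputable section

open Set Function Metric Filter Module
open scoped Topology ContDiff Manifold RealInnerProductSpace

namespace Literature.Topology.FourManifolds

variable {k : ℕ}

local notation "𝔽[" n "]" => EuclideanSpace ℝ (Fin (n + 1))
local notation "𝕊[" n "]" => (Metric.sphere (0 : EuclideanSpace ℝ (Fin (n + 1))) 1)

/-! ### Positively homogeneous homeomorphisms and their ray maps -/

section Ray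

variable {θ₀ : 𝕊[k]}

/-- A positively homogeneous map fixes the origin. [folklore] -/
theorem map_zero_of_posHomogeneous {L : 𝔽[k] → 𝔽[k]}
    (hL : ∀ (v : 𝔽[k]) (c : ℝ), 0 ≤ c → L (c • v) = c • L v) : L 0 = 0 := by
  simpa using hL 0 0 le_rfl

/-- A positively homogeneous homeomorphism does not vanish on the unit sphere. [folklore] -/
theorem apply_ne_zero_of_posHomogeneous (L : 𝔽[k] ≃ₜ 𝔽[k])
    (hL : ∀ (v : 𝔽[k]) (c : ℝ), 0 ≤ c → L (c • v) = c • L v) (θ : 𝕊[k]) :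
    L (θ : 𝔽[k]) ≠ 0 := fun h =>
  ne_zero_of_mem_unit_sphere θ (L.injective (h.trans (map_zero_of_posHomogeneous hL).symm))

/-- The inverse of a positively homogeneous homeomorphism is positively homogeneous. [folklore] -/
theorem symm_posHomogeneous (L : 𝔽[k] ≃ₜ 𝔽[k])
    (hL : ∀ (v : 𝔽[k]) (c : ℝ), 0 ≤ c → L (c • v) = c • L v) :
    ∀ (w : 𝔽[k]) (c : ℝ), 0 ≤ c → L.symm (c • w) = c • L.symm w := by
  intro w c hc
  apply L.injective
  rw [L.apply_symm_apply, hL _ _ hc, L.apply_symm_apply]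

/-- **The ray map** `θ ↦ L θ / ‖L θ‖` of a map of `ℝᵏ⁺¹` on the unit sphere (junk value where
`L θ = 0`). [folklore] -/
def rayMap (θ₀ : 𝕊[k]) (L : 𝔽[k] → 𝔽[k]) (θ : 𝕊[k]) : 𝕊[k] :=
  radialProjection θ₀ (L θ)

/-- The ray map in coordinates. [folklore] -/
theorem coe_rayMap {L : 𝔽[k] → 𝔽[k]} {θ : 𝕊[k]} (h : L θ ≠ 0) :
    (rayMap θ₀ L θ : 𝔽[k]) = ‖L (θ : 𝔽[k])‖⁻¹ • L θ :=
  coe_radialProjection_of_ne_zero θ₀ h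

/-- The ray map of a positively homogeneous homeomorphism is continuous. [folklore] -/
theorem continuous_rayMap (L : 𝔽[k] ≃ₜ 𝔽[k])
    (hL : ∀ (v : 𝔽[k]) (c : ℝ), 0 ≤ c → L (c • v) = c • L v) : Continuous (rayMap θ₀ L) :=
  (continuousOn_radialProjection θ₀).comp_continuous (L.continuous.comp continuous_subtype_val)
    fun θ => apply_ne_zero_of_posHomogeneous L hL θ

/-- The ray maps of `L⁻¹` and `L` are inverse to each other. [folklore] -/
theorem rayMap_symm_rayMap (L : 𝔽[k] ≃ₜ 𝔽[k])
    (hL : ∀ (v : 𝔽[k]) (c : ℝ), 0 ≤ c → L (c • v) = c • L v) (θ : 𝕊[k]) :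
    rayMap θ₀ L.symm (rayMap θ₀ L θ) = θ := by
  have h1 : L (θ : 𝔽[k]) ≠ 0 := apply_ne_zero_of_posHomogeneous L hL θ
  have h2 : L.symm ((rayMap θ₀ L θ : 𝕊[k]) : 𝔽[k]) ≠ 0 :=
    apply_ne_zero_of_posHomogeneous L.symm (symm_posHomogeneous L hL) _
  ext1
  rw [coe_rayMap h2, coe_rayMap h1, symm_posHomogeneous L hL _ _ (inv_nonneg.2 (norm_nonneg _)),
    L.symm_apply_apply, norm_smul, norm_inv, norm_norm, norm_eq_of_mem_sphere, mul_one, inv_inv,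
    smul_smul, mul_inv_cancel₀ (norm_ne_zero_iff.2 h1), one_smul]

/-- **The ray homeomorphism** of a positively homogeneous homeomorphism `L` of `ℝᵏ⁺¹`: the map
`θ ↦ L θ / ‖L θ‖` of the unit sphere, with inverse the ray map of `L⁻¹`. (For the conewise
differential of a PD homeomorphism at a point, Munkres (1966), Thm. 8.4, this is the
"tangent link" homeomorphism.) [folklore] -/
def rayHomeomorph (θ₀ : 𝕊[k]) (L : 𝔽[k] ≃ₜ 𝔽[k])
    (hL : ∀ (v : 𝔽[k]) (c : ℝ), 0 ≤ c → L (c • v) = c • L v) : 𝕊[k] ≃ₜ 𝕊[k] where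
  toFun := rayMap θ₀ L
  invFun := rayMap θ₀ L.symm
  left_inv := rayMap_symm_rayMap L hL
  right_inv θ := by
    simpa using rayMap_symm_rayMap (θ₀ := θ₀) L.symm (symm_posHomogeneous L hL) θ
  continuous_toFun := continuous_rayMap L hL
  continuous_invFun := continuous_rayMap L.symm (symm_posHomogeneous L hL)

/-- The ray homeomorphism in coordinates. [folklore] -/
theorem coe_rayHomeomorph (L : 𝔽[k] ≃ₜ 𝔽[k])
    (hL : ∀ (v : 𝔽[k]) (c : ℝ), 0 ≤ c → L (c • v) = c • L v) (θ : 𝕊[k]) :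
    ((rayHomeomorph θ₀ L hL θ : 𝕊[k]) : 𝔽[k]) = ‖L (θ : 𝔽[k])‖⁻¹ • L θ :=
  coe_rayMap (apply_ne_zero_of_posHomogeneous L hL θ)

end Ray

/-! ### Normalisation is Lipschitz away from the origin -/

section Normalise

variable {G : Type*} [NormedAddCommGroup G] [NormedSpace ℝ G]

/-- **`‖a/‖a‖ - b/‖b‖‖ ≤ 2 ‖a - b‖ / ‖b‖`** for nonzero `a`, `b`. [folklore] -/
theorem norm_inv_norm_smul_sub_inv_norm_smul_le {a b : G} (ha : a ≠ 0) (hb : b ≠ 0) :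
    ‖‖a‖⁻¹ • a - ‖b‖⁻¹ • b‖ ≤ 2 * ‖a - b‖ / ‖b‖ := by
  have ha0 : 0 < ‖a‖ := norm_pos_iff.2 ha
  have hb0 : 0 < ‖b‖ := norm_pos_iff.2 hb
  calc ‖‖a‖⁻¹ • a - ‖b‖⁻¹ • b‖
      ≤ ‖‖a‖⁻¹ • a - ‖b‖⁻¹ • a‖ + ‖‖b‖⁻¹ • a - ‖b‖⁻¹ • b‖ := norm_sub_le_norm_sub_add_norm_sub _ _ _
    _ = |‖a‖⁻¹ - ‖b‖⁻¹| * ‖a‖ + ‖b‖⁻¹ * ‖a - b‖ := by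
        rw [← sub_smul, norm_smul, ← smul_sub, norm_smul, Real.norm_eq_abs, Real.norm_eq_abs,
          abs_of_pos (inv_pos.2 hb0)]
    _ = |‖b‖ - ‖a‖| / ‖b‖ + ‖a - b‖ / ‖b‖ := by
        rw [inv_sub_inv ha0.ne' hb0.ne', abs_div, abs_of_pos (mul_pos ha0 hb0)]
        field_simp
    _ ≤ ‖a - b‖ / ‖b‖ + ‖a - b‖ / ‖b‖ := by
        gcongr
        rw [abs_sub_comm]
        exact abs_norm_sub_norm_le a b
    _ = 2 * ‖a - b‖ / ‖b‖ := by ring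

/-- Normalising a positive multiple. [folklore] -/
theorem inv_norm_smul_smul_eq {c : ℝ} (hc : 0 < c) (v : G) :
    ‖c • v‖⁻¹ • (c • v) = ‖v‖⁻¹ • v := by
  by_cases hv : v = 0
  · simp [hv]
  · rw [norm_smul, Real.norm_eq_abs, abs_of_pos hc, mul_inv, smul_smul, mul_comm c⁻¹, mul_assoc,
      inv_mul_cancel₀ hc.ne', mul_one]

end Normalise

/-! ### Link maps close to the ray homeomorphism -/

section Link

variable {E : Type*} [NormedAddCommGroup E] [NormedSpace ℝ E]
variable {θ₀ : 𝕊[k]} {N : E × 𝔽[k] → 𝔽[k]} {x₀ : E} {r₁ μ δ : ℝ}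

omit [NormedAddCommGroup E] [NormedSpace ℝ E] in
/-- **Closeness of the link map to the ray homeomorphism.** Let `L` be a positively homogeneous
homeomorphism of `ℝᵏ⁺¹` with `μ ‖v‖ ≤ ‖L v‖`, and suppose the rescaled fibre map at radius `r₁`
is uniformly `δ`-close to `L` on the unit sphere, `‖r₁⁻¹ N (x₀, r₁ θ) - L θ‖ ≤ δ`, with
`2δ < μ`.  Then `N (x₀, r₁ θ) ≠ 0` and the link map `linkSphereMap θ₀ N r₁ x₀` is pointwise at
chordal distance `< 1` from `rayHomeomorph θ₀ L`. [folklore] -/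
theorem norm_linkSphereMap_sub_rayHomeomorph_lt (L : 𝔽[k] ≃ₜ 𝔽[k])
    (hL : ∀ (v : 𝔽[k]) (c : ℝ), 0 ≤ c → L (c • v) = c • L v) (hr : 0 < r₁) (hμ : 0 < μ)
    (hμL : ∀ v : 𝔽[k], μ * ‖v‖ ≤ ‖L v‖)
    (hδ : ∀ θ : 𝕊[k], ‖r₁⁻¹ • N (x₀, r₁ • (θ : 𝔽[k])) - L θ‖ ≤ δ) (hδμ : 2 * δ < μ)
    (θ : 𝕊[k]) :
    N (x₀, r₁ • (θ : 𝔽[k])) ≠ 0 ∧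
      ‖(linkSphereMap θ₀ N r₁ x₀ θ : 𝔽[k]) - rayHomeomorph θ₀ L hL θ‖ < 1 := by
  have hLθ : μ ≤ ‖L (θ : 𝔽[k])‖ := by simpa [norm_eq_of_mem_sphere] using hμL θ
  have hLθ0 : 0 < ‖L (θ : 𝔽[k])‖ := hμ.trans_le hLθ
  set a : 𝔽[k] := r₁⁻¹ • N (x₀, r₁ • (θ : 𝔽[k])) with ha_def
  have ha : ‖a - L θ‖ ≤ δ := hδ θ
  have hδ0 : 0 ≤ δ := (norm_nonneg _).trans ha
  have ha0 : a ≠ 0 := by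
    intro h
    rw [h, zero_sub, norm_neg] at ha
    linarith
  have hN0 : N (x₀, r₁ • (θ : 𝔽[k])) ≠ 0 := by
    intro h
    apply ha0
    rw [ha_def, h, smul_zero]
  refine ⟨hN0, ?_⟩
  have hlink : (linkSphereMap θ₀ N r₁ x₀ θ : 𝔽[k]) = ‖a‖⁻¹ • a := by
    rw [coe_linkSphereMap hN0, ha_def, inv_norm_smul_smul_eq (inv_pos.2 hr)]
  rw [hlink, coe_rayHomeomorph L hL θ]
  calc ‖‖a‖⁻¹ • a - ‖L (θ : 𝔽[k])‖⁻¹ • L θ‖ ≤ 2 * ‖a - L θ‖ / ‖L (θ : 𝔽[k])‖ :=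
        norm_inv_norm_smul_sub_inv_norm_smul_le ha0 (apply_ne_zero_of_posHomogeneous L hL θ)
    _ ≤ 2 * δ / μ := by gcongr
    _ < 1 := by rw [div_lt_one hμ]; exact hδμ

/-- **The circle link map is a diffeomorphism** (`k = 1`).  If `N` is smooth at the link points
`(x₀, r₁ θ)`, with injective fibre derivative and radially transversal there (the link data of a
readable shell), and the rescaled fibre map at radius `r₁` is uniformly `δ`-close on the unit
circle to a positively homogeneous homeomorphism `L` of `ℝ²` bounded below by `μ ‖·‖`, `2δ < μ`
(in the sweep: `L` the conewise differential of the current map at the point, Munkres (1966)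
Thm. 8.4, and `δ` from the uniform convergence of its rescalings plus the `C⁰`-smallness of the
crease bands), then `linkSphereMap θ₀ N r₁ x₀` is (the map of) a diffeomorphism of `𝕊¹`.
[cite: CampbellDonofrioVitek2026, Lemma 3.2] -/
theorem exists_linkDiffeomorph_circle {θ₀ : 𝕊[1]} {N : E × 𝔽[1] → 𝔽[1]} {x₀ : E}
    {r₁ μ δ : ℝ} (hr : 0 < r₁)
    (hN : ∀ θ : 𝕊[1], ContDiffAt ℝ ∞ N (x₀, r₁ • (θ : 𝔽[1])))
    (hinj : ∀ θ : 𝕊[1], ∀ u : 𝔽[1], fderiv ℝ N (x₀, r₁ • (θ : 𝔽[1])) (0, u) = 0 → u = 0)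
    (htr : ∀ θ : 𝕊[1], ∀ v : 𝔽[1], fderiv ℝ N (x₀, r₁ • (θ : 𝔽[1])) (0, v) =
      N (x₀, r₁ • (θ : 𝔽[1])) → 0 < ⟪v, (θ : 𝔽[1])⟫)
    (L : 𝔽[1] ≃ₜ 𝔽[1]) (hL : ∀ (v : 𝔽[1]) (c : ℝ), 0 ≤ c → L (c • v) = c • L v) (hμ : 0 < μ)
    (hμL : ∀ v : 𝔽[1], μ * ‖v‖ ≤ ‖L v‖)
    (hδ : ∀ θ : 𝕊[1], ‖r₁⁻¹ • N (x₀, r₁ • (θ : 𝔽[1])) - L θ‖ ≤ δ) (hδμ : 2 * δ < μ) :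
    ∃ φ : 𝕊[1] ≃ₘ⟮𝓡 1, 𝓡 1⟯ 𝕊[1], ∀ θ, φ θ = linkSphereMap θ₀ N r₁ x₀ θ := by
  haveI : Fact (finrank ℝ (EuclideanSpace ℝ (Fin (1 + 1))) = 1 + 1) := ⟨finrank_euclideanSpace_fin⟩
  have hclose := fun θ => norm_linkSphereMap_sub_rayHomeomorph_lt (θ₀ := θ₀) L hL hr hμ hμL hδ hδμ θ
  have hN0 : ∀ θ : 𝕊[1], N (x₀, r₁ • (θ : 𝔽[1])) ≠ 0 := fun θ => (hclose θ).1
  set ĥ : 𝕊[1] → 𝕊[1] := linkSphereMap θ₀ N r₁ x₀ with hĥ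
  have hsm : ContMDiff (𝓡 1) (𝓡 1) ∞ ĥ := fun θ =>
    (contMDiffAt_uncurry_linkSphereMap (θ₀ := θ₀) (hN θ) (hN0 θ)).comp θ
      (contMDiffAt_const.prodMk contMDiffAt_id)
  have hkey : ∀ θ, Injective (mfderiv (𝓡 1) (𝓡 1) ĥ θ) := fun θ =>
    injective_mfderiv_linkSphereMap hr (hN θ) (hN0 θ) (hinj θ) (htr θ)
  exact exists_diffeomorph_circle_of_close hsm hkey (rayHomeomorph θ₀ L hL) fun θ => (hclose θ).2

end Link

end Literature.Topology.FourManifolds
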